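import Summits.QuantumFields.YangMills.Theorems.BalabanLadderIRPinnedExit96
import HarnessLib

/-!
# IR cell, crux `BalabanLadder.IR` (stmt-QuantumFields-19354): the THERMAL-RATCHET SEAM factors through the pinned exit `PX`

HONEST FRAMING.  Content-free glue over landed rungs.  Nothing here proves the Yang–Mills mass gap (Clay), the crux `IR`, any purity
certificate or any heredity/monotonicity statement; R4 (`BalabanUVStability4`) closes only the conditional finite-𝕋⁴ rung `BalabanLadder.UV`.

WHAT IS PROVED (ideator ym-ir-idea-11, line `thermal-ratchet`, lens «finite»; critic ym-ir-crit-3 PASS-WITH-PRICE, «LAND the sorry-free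
seams» 2026-08-28T06:37:04Z / 06:39:41Z).  Currency: the cold purity defect `δᶜ_β(L) = coldDefect r.ρ β L = 1 − Z_β(L³×2⌊L/4⌋)/Z_β(L³×⌊L/4⌋)²`.
The line splits the pinned exit **PX_θ'** (`PinnedExit96.PinnedExitAt θ'`: for all large `β` a `θ'`-pure cold box `L ≥ 8` of bounded physical
size `a(β)·L ≤ T`, AT the coupling `β`) into two obligations of different kinds:

* **HEREDITY DOWN IN β at fixed lattice size** (the SIGN; hypothesis `hM`, unfolded): eventually in `β`, for `β₀ ≤ β ≤ β'` and every `L ≥ 8`,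
  `δᶜ_{β'}(L) ≤ θ ⇒ δᶜ_β(L) ≤ θ'` — «coarser coupling = bigger physical box on the same lattice = purer»; group-blind (true for `U(1)₄` too),
  no Yang–Mills content, no known proof tool (the finite-box form of interaction-measure positivity);
* **PINNED COFINAL θ-CERTIFICATES** (the INSTANCES; hypothesis `hC`, unfolded): for all large `β` SOME coupling `βs ≥ β` carries a `θ`-pure cold
  box `L ≥ 8` with `a(β)·L ≤ T` — decidable one-box facts at couplings of the certifier's choosing (E-type Yang–Mills content; false for `U(1)₄`).

* `pinnedExitAt_of_heredity_of_pinnedCertificates : hM → hC → PinnedExitAt θ'` (pure logic: hand the certificate down from `βs` to `β`);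
* `irsc_of_heredity_of_pinnedCertificates (hθ' : θ' ≤ 1/24) : hM → hC → ColdPressurePincer.IRsc` (then `PinnedExit96.irsc_of_pinnedExit_le`,
  i.e. the tree's purity climb `PurityClimb.coldDefect_widen_24` + the cold-pressure pincer); `ColdPressurePincer.IR_of_cases : IRsc → IRnsc →
  BalabanLadder.IR` (tree) finishes by name;
* named instances: `irsc_of_ratchet24` (θ = 1/48, θ' = 1/24 — the line's bill of record, rev 13), `irsc_of_heredity24` (θ = θ' = 1/24, no slack),
  `irsc_of_hereditySlack25` (θ = 2⁻²⁵, θ' = 2⁻²⁴ — the deep slack edition, rev 7/12);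
* `pinnedCertificates_of_pinnedExitAt : PinnedExitAt θ → hC` (the converse bookkeeping: PX is the case `βs = β`).

The obligations are registered as stubs only in the crux workfile `Cruxes/IR/Lines/thermal_ratchet.lean`, never here.  bears_on: R2c.
-/

set_option autoImplicit false

noncomputable section

open Filter Topology MeasureTheory
open Literature.MathematicalPhysics.QuantumFieldTheory Literature.MathematicalPhysics.QuantumLattice
open Summit.QuantumFields.YangMills.Cruxes.IR.ColdPurityBridge (coldDefect)
open Summit.QuantumFields.YangMills.Cruxes.IR.ColdPressurePincer (IRsc)
open Summit.QuantumFields.YangMills.Cruxes.OSLegsFromFemtoAndGap.DlrCollarTransfer (LowerBounds)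
open Summit.QuantumFields.YangMills.Cruxes.IR.PinnedExit96 (PinnedExitAt irsc_of_pinnedExit_le)

namespace Summit.QuantumFields.YangMills.Cruxes.IR.ThermalRatchetSeam

/-- **HEREDITY + PINNED COFINAL CERTIFICATES ⇒ PINNED EXIT (pure logic).**  If (eventually in β) a `θ`-pure cold `L`-box at a finer coupling
`β' ≥ β` forces a `θ'`-pure one at `β` on the same lattice, and for all large `β` some `βs ≥ β` carries a `θ`-pure cold box `L ≥ 8` with
`a(β)·L ≤ T`, then for all large `β` the box is `θ'`-pure AT `β`: `PinnedExit96.PinnedExitAt θ'` with the same `T`. -/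
theorem pinnedExitAt_of_heredity_of_pinnedCertificates {θ θ' : ℝ}
    (hM : ∀ (G : Type) [Group G] [TopologicalSpace G] [IsTopologicalGroup G] [CompactSpace G],
      IsCompactSimpleLieGroup G → SimplyConnectedSpace G →
      letI : MeasurableSpace G := borel G
      haveI : BorelSpace G := ⟨rfl⟩
      ∀ r : LatticeRep G, ∃ β₀ : ℝ, ∀ β β' : ℝ, β₀ ≤ β → β ≤ β' → ∀ L : ℕ, 8 ≤ L →
        coldDefect r.ρ β' L ≤ θ → coldDefect r.ρ β L ≤ θ')
    (hC : ∀ (G : Type) [Group G] [TopologicalSpace G] [IsTopologicalGroup G] [CompactSpace G],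
      IsCompactSimpleLieGroup G → SimplyConnectedSpace G →
      letI : MeasurableSpace G := borel G
      haveI : BorelSpace G := ⟨rfl⟩
      ∀ (r : LatticeRep G) (a : ℝ → ℝ), (∀ β, 0 < a β) → Tendsto a atTop (𝓝 0) → LowerBounds G r a →
        ∃ T β₁ : ℝ, ∀ β : ℝ, β₁ ≤ β →
          ∃ βs : ℝ, β ≤ βs ∧ ∃ L : ℕ, 8 ≤ L ∧ a β * (L : ℝ) ≤ T ∧ coldDefect r.ρ βs L ≤ θ) :
    PinnedExitAt θ' := by
  intro G _ _ _ _ hG hsc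
  letI : MeasurableSpace G := borel G
  haveI : BorelSpace G := ⟨rfl⟩
  intro r a ha ha0 hlb
  obtain ⟨β₀, hβ₀⟩ := hM G hG hsc r
  obtain ⟨T, β₁, hcert⟩ := hC G hG hsc r a ha ha0 hlb
  refine ⟨T, max β₀ β₁, fun β hβ => ?_⟩
  obtain ⟨βs, hββs, L, hL, hpin, hδ⟩ := hcert β (le_trans (le_max_right _ _) hβ)
  exact ⟨L, hL, hpin, hβ₀ β βs (le_trans (le_max_left _ _) hβ) hββs L hL hδ⟩

/-- **The converse bookkeeping: PX_θ is the case `βs = β` of the pinned cofinal θ-certificates** (so with trivial heredity the two bills agree). -/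
theorem pinnedCertificates_of_pinnedExitAt {θ : ℝ} (hP : PinnedExitAt θ) :
    ∀ (G : Type) [Group G] [TopologicalSpace G] [IsTopologicalGroup G] [CompactSpace G],
      IsCompactSimpleLieGroup G → SimplyConnectedSpace G →
      letI : MeasurableSpace G := borel G
      haveI : BorelSpace G := ⟨rfl⟩
      ∀ (r : LatticeRep G) (a : ℝ → ℝ), (∀ β, 0 < a β) → Tendsto a atTop (𝓝 0) → LowerBounds G r a →
        ∃ T β₁ : ℝ, ∀ β : ℝ, β₁ ≤ β →
          ∃ βs : ℝ, β ≤ βs ∧ ∃ L : ℕ, 8 ≤ L ∧ a β * (L : ℝ) ≤ T ∧ coldDefect r.ρ βs L ≤ θ := by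
  intro G _ _ _ _ hG hsc
  letI : MeasurableSpace G := borel G
  haveI : BorelSpace G := ⟨rfl⟩
  intro r a ha ha0 hlb
  obtain ⟨T, β₁, h⟩ := hP G hG hsc r a ha ha0 hlb
  exact ⟨T, β₁, fun β hβ => ⟨β, le_rfl, h β hβ⟩⟩

/-- **THE THERMAL-RATCHET SEAM (unfolded; any tolerances `θ`, `θ' ≤ 1/24`).**  Heredity down in β at fixed lattice size + pinned cofinal
`θ`-certificates ⇒ `ColdPressurePincer.IRsc` — through `PinnedExitAt θ'` and the tree's `PinnedExit96.irsc_of_pinnedExit_le` (purity climb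
`PurityClimb.coldDefect_widen_24` at the same coupling, cold pressure at `2¹⁴·L ≤ 2¹⁴·T/a(β)`, `gapInUnits_of_coldPressure_pinned`). -/
theorem irsc_of_heredity_of_pinnedCertificates {θ θ' : ℝ} (hθ' : θ' ≤ 1 / 24)
    (hM : ∀ (G : Type) [Group G] [TopologicalSpace G] [IsTopologicalGroup G] [CompactSpace G],
      IsCompactSimpleLieGroup G → SimplyConnectedSpace G →
      letI : MeasurableSpace G := borel G
      haveI : BorelSpace G := ⟨rfl⟩
      ∀ r : LatticeRep G, ∃ β₀ : ℝ, ∀ β β' : ℝ, β₀ ≤ β → β ≤ β' → ∀ L : ℕ, 8 ≤ L →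
        coldDefect r.ρ β' L ≤ θ → coldDefect r.ρ β L ≤ θ')
    (hC : ∀ (G : Type) [Group G] [TopologicalSpace G] [IsTopologicalGroup G] [CompactSpace G],
      IsCompactSimpleLieGroup G → SimplyConnectedSpace G →
      letI : MeasurableSpace G := borel G
      haveI : BorelSpace G := ⟨rfl⟩
      ∀ (r : LatticeRep G) (a : ℝ → ℝ), (∀ β, 0 < a β) → Tendsto a atTop (𝓝 0) → LowerBounds G r a →
        ∃ T β₁ : ℝ, ∀ β : ℝ, β₁ ≤ β →
          ∃ βs : ℝ, β ≤ βs ∧ ∃ L : ℕ, 8 ≤ L ∧ a β * (L : ℝ) ≤ T ∧ coldDefect r.ρ βs L ≤ θ) :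
    IRsc :=
  irsc_of_pinnedExit_le hθ' (pinnedExitAt_of_heredity_of_pinnedCertificates hM hC)

/-- **The few-percent edition (the line's bill of record, rev 13): θ = 1/48 → θ' = 1/24.**  «A `1/48`-pure cold box at the finer coupling is
`1/24`-pure at the coarser one, same lattice size, eventually in β» + «pinned cofinal `1/48`-certificates» ⇒ `IRsc`. -/
theorem irsc_of_ratchet24
    (hM : ∀ (G : Type) [Group G] [TopologicalSpace G] [IsTopologicalGroup G] [CompactSpace G],
      IsCompactSimpleLieGroup G → SimplyConnectedSpace G →
      letI : MeasurableSpace G := borel G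
      haveI : BorelSpace G := ⟨rfl⟩
      ∀ r : LatticeRep G, ∃ β₀ : ℝ, ∀ β β' : ℝ, β₀ ≤ β → β ≤ β' → ∀ L : ℕ, 8 ≤ L →
        coldDefect r.ρ β' L ≤ 1 / 48 → coldDefect r.ρ β L ≤ 1 / 24)
    (hC : ∀ (G : Type) [Group G] [TopologicalSpace G] [IsTopologicalGroup G] [CompactSpace G],
      IsCompactSimpleLieGroup G → SimplyConnectedSpace G →
      letI : MeasurableSpace G := borel G
      haveI : BorelSpace G := ⟨rfl⟩
      ∀ (r : LatticeRep G) (a : ℝ → ℝ), (∀ β, 0 < a β) → Tendsto a atTop (𝓝 0) → LowerBounds G r a →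
        ∃ T β₁ : ℝ, ∀ β : ℝ, β₁ ≤ β →
          ∃ βs : ℝ, β ≤ βs ∧ ∃ L : ℕ, 8 ≤ L ∧ a β * (L : ℝ) ≤ T ∧ coldDefect r.ρ βs L ≤ 1 / 48) :
    IRsc :=
  irsc_of_heredity_of_pinnedCertificates (θ := 1 / 48) (θ' := 1 / 24) le_rfl hM hC

/-- **No-slack few-percent edition: θ = θ' = 1/24** (plain heredity of `1/24`-purity down in β + pinned cofinal `1/24`-certificates ⇒ `IRsc`). -/
theorem irsc_of_heredity24
    (hM : ∀ (G : Type) [Group G] [TopologicalSpace G] [IsTopologicalGroup G] [CompactSpace G],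
      IsCompactSimpleLieGroup G → SimplyConnectedSpace G →
      letI : MeasurableSpace G := borel G
      haveI : BorelSpace G := ⟨rfl⟩
      ∀ r : LatticeRep G, ∃ β₀ : ℝ, ∀ β β' : ℝ, β₀ ≤ β → β ≤ β' → ∀ L : ℕ, 8 ≤ L →
        coldDefect r.ρ β' L ≤ 1 / 24 → coldDefect r.ρ β L ≤ 1 / 24)
    (hC : ∀ (G : Type) [Group G] [TopologicalSpace G] [IsTopologicalGroup G] [CompactSpace G],
      IsCompactSimpleLieGroup G → SimplyConnectedSpace G →
      letI : MeasurableSpace G := borel G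
      haveI : BorelSpace G := ⟨rfl⟩
      ∀ (r : LatticeRep G) (a : ℝ → ℝ), (∀ β, 0 < a β) → Tendsto a atTop (𝓝 0) → LowerBounds G r a →
        ∃ T β₁ : ℝ, ∀ β : ℝ, β₁ ≤ β →
          ∃ βs : ℝ, β ≤ βs ∧ ∃ L : ℕ, 8 ≤ L ∧ a β * (L : ℝ) ≤ T ∧ coldDefect r.ρ βs L ≤ 1 / 24) :
    IRsc :=
  irsc_of_heredity_of_pinnedCertificates (θ := 1 / 24) (θ' := 1 / 24) le_rfl hM hC

/-- **The deep slack edition (rev 7/12): θ = 2⁻²⁵ → θ' = 2⁻²⁴** (basin heredity with a factor-2 slack at the tree's seed depth + pinned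
cofinal `2⁻²⁵`-certificates ⇒ `IRsc`). -/
theorem irsc_of_hereditySlack25
    (hM : ∀ (G : Type) [Group G] [TopologicalSpace G] [IsTopologicalGroup G] [CompactSpace G],
      IsCompactSimpleLieGroup G → SimplyConnectedSpace G →
      letI : MeasurableSpace G := borel G
      haveI : BorelSpace G := ⟨rfl⟩
      ∀ r : LatticeRep G, ∃ β₀ : ℝ, ∀ β β' : ℝ, β₀ ≤ β → β ≤ β' → ∀ L : ℕ, 8 ≤ L →
        coldDefect r.ρ β' L ≤ 1 / 2 ^ 25 → coldDefect r.ρ β L ≤ 1 / 2 ^ 24)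
    (hC : ∀ (G : Type) [Group G] [TopologicalSpace G] [IsTopologicalGroup G] [CompactSpace G],
      IsCompactSimpleLieGroup G → SimplyConnectedSpace G →
      letI : MeasurableSpace G := borel G
      haveI : BorelSpace G := ⟨rfl⟩
      ∀ (r : LatticeRep G) (a : ℝ → ℝ), (∀ β, 0 < a β) → Tendsto a atTop (𝓝 0) → LowerBounds G r a →
        ∃ T β₁ : ℝ, ∀ β : ℝ, β₁ ≤ β →
          ∃ βs : ℝ, β ≤ βs ∧ ∃ L : ℕ, 8 ≤ L ∧ a β * (L : ℝ) ≤ T ∧ coldDefect r.ρ βs L ≤ 1 / 2 ^ 25) :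
    IRsc :=
  irsc_of_heredity_of_pinnedCertificates (θ := 1 / 2 ^ 25) (θ' := 1 / 2 ^ 24) (by norm_num) hM hC

end Summit.QuantumFields.YangMills.Cruxes.IR.ThermalRatchetSeam

end
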